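import Summits.KontsevichZagierPeriods.KontsevichZagierPeriods.Theorems.LinRedNormalFormArrangementNormalFormStubRebaseSimpleZeroManyChainTools

/-!
# Stub `stub_rebaseSimpleZeroMany`, part `rebaseSimpleZeroMany_common` (crux `ArrangementNormalForm`,
line `janus-bands`) — brick `ChainReflect`

**Reflection of a clean chain** `A < t₀ < ⋯ < tₙ < B` of `n + 1` fibres over a one-dimensional
base (constant letters, `RebaseChain.IsChain`): the reflection `t ↦ −t` of all fibres
(`RebasePos.pull` with `μ = −1`, rule 2) followed by the REVERSAL of the fibre indices (the
coordinate permutation `RebaseChain.revIdx`, rule 2: `KZ.IntegralRep.reindex`,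
`KZ.of_sub_of_reindex_mem_permRel`) is again a clean chain in index order,
`−B < sₒ < ⋯ < sₙ < −A` with `sₗ = −t_{n−l}`, letters `−a_{n−l}` (`RebaseChain.IsChain.reflect`).
This turns downward-opening pinch ends into upward-opening ones and super-sections into
sub-sections. Registered: `rebaseSimpleZeroMany_chainReflect`.

References: M. Kontsevich, D. Zagier, *Periods* (2001), §1.2, rule (2).
-/

noncomputable section

open Set MeasureTheory MvPolynomial
open Literature.NumberTheory.Transcendental Literature.ModelTheory.ExponentialFields

namespace Summit.KontsevichZagierPeriods.ArrangementNormalForm.JanusBands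

namespace RebaseChain

open SeparatePos RebasePos RebaseZero RebaseNest

variable {n : ℕ}

/-! ### Reversing the order of the fibres -/

/-- The coordinate permutation of `ℝ^{1 + (n + 1)}` fixing the base and reversing the fibres.
[folklore] -/
def revIdx (n : ℕ) : Equiv.Perm (Fin (0 + 1 + (n + 1))) :=
  finSumFinEquiv.symm.trans ((Equiv.sumCongr (Equiv.refl (Fin (0 + 1))) Fin.revPerm).trans
    finSumFinEquiv)

/-- `revIdx` fixes the base coordinate. -/
@[simp] theorem revIdx_castAdd (j : Fin (0 + 1)) :
    revIdx n (Fin.castAdd (n + 1) j) = Fin.castAdd (n + 1) j := by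
  simp [revIdx]

/-- `revIdx` reverses the fibre coordinates. -/
@[simp] theorem revIdx_natAdd (l : Fin (n + 1)) :
    revIdx n (Fin.natAdd (0 + 1) l) = Fin.natAdd (0 + 1) (Fin.rev l) := by
  simp [revIdx]

/-- The base coordinate after reversal. -/
theorem yv_revIdx (w : Fin (0 + 1 + (n + 1)) → ℝ) : yv (fun i => w (revIdx n i)) = yv w := by
  simp only [yv, yIdx, revIdx_castAdd]

/-- The fibre coordinates after reversal. -/
theorem tv_revIdx (w : Fin (0 + 1 + (n + 1)) → ℝ) :
    tv (fun i => w (revIdx n i)) = fun l => tv w (Fin.rev l) := by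
  funext l
  simp only [tv, tIdx, revIdx_natAdd]

/-- The literal integrand after reversing the fibres: the letters are reversed. [folklore] -/
theorem glit_revIdx {m : ℕ} (p : MvPolynomial (Fin 0) ℚ) (L : Fin m → (Fin 0 → ℚ) × ℚ) (e : Fin m → ℕ)
    (ℓ₁ ℓ₂ : (Fin 0 → ℚ) × ℚ) (n₁ n₂ : ℕ) (a : Fin (n + 1) → Option Cf)
    (w : Fin (0 + 1 + (n + 1)) → ℝ) :
    glit 0 (n + 1) p L e ℓ₁ ℓ₂ n₁ n₂ a (fun i => w (revIdx n i)) =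
      glit 0 (n + 1) p L e ℓ₁ ℓ₂ n₁ n₂ (fun l => a (Fin.rev l)) w := by
  simp only [glit, revIdx_castAdd, revIdx_natAdd]
  congr 1
  exact Fintype.prod_equiv Fin.revPerm _ _ fun l => by simp only [Fin.revPerm_apply, Fin.rev_rev]

/-- Negating and reversing a strictly increasing family keeps it strictly increasing. [folklore] -/
theorem strictMono_neg_rev {f : Fin (n + 1) → ℝ} :
    StrictMono (fun l => -f (Fin.rev l)) ↔ StrictMono f := by
  constructor
  · intro h i j hij
    have := h (Fin.rev_lt_rev.2 hij)
    simp only [Fin.rev_rev, neg_lt_neg_iff] at this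
    exact this
  · intro h i j hij
    exact neg_lt_neg (h (Fin.rev_lt_rev.2 hij))

/-! ### The reflection of a clean chain -/

variable {m' : ℕ} {s : KZ.IntegralRep (0 + 1 + (n + 1))} {M : Fin m' → Cf} {A Bd : Cf} {T : BData}
  {p : MvPolynomial (Fin 0) ℚ} {a : Fin (n + 1) → Option Cf}

/-- The base coordinate is unchanged by the reflection `t ↦ −t`. -/
theorem yv_pullInv_neg (w : Fin (0 + 1 + (n + 1)) → ℝ) :
    yv (pullInv (fun _ : Fin (n + 1) => (-1 : ℚ)) (fun _ => 0) (fun _ => 0) w) = yv w := by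
  simp only [yv, yIdx, pullInv_base]

/-- The fibres are negated by the reflection `t ↦ −t`. -/
theorem tv_pullInv_neg (w : Fin (0 + 1 + (n + 1)) → ℝ) :
    tv (pullInv (fun _ : Fin (n + 1) => (-1 : ℚ)) (fun _ => 0) (fun _ => 0) w) = fun l => -tv w l := by
  funext l
  simp only [tv, tIdx, pullInv_fib, affB, Rat.cast_neg, Rat.cast_one, Rat.cast_zero,
    Finset.univ_eq_empty, Finset.sum_empty, Prod.snd_zero, Prod.fst_zero]
  ring

/-- **Reflection of a clean chain** (rule 2, twice: `t ↦ −t` on all fibres, then the reversal of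
the fibre indices). The clean chain `A < t₀ < ⋯ < tₙ < B` becomes the clean chain
`−B < s₀ < ⋯ < sₙ < −A` (`sₗ = −t_{n−l}`), the letters are negated and reversed, the numerator
picks up the sign `RebasePos.pullQ`. [Kontsevich–Zagier 2001, §1.2, rule (2)] -/
theorem IsChain.reflect (h : IsChain s M A Bd T p a) : ∃ s' : KZ.IntegralRep (0 + 1 + (n + 1)),
    IsChain s' M (-Bd) (-A) T (C (pullQ (fun _ : Fin (n + 1) => (-1 : ℚ)) a) * p)
      (fun l => (a (Fin.rev l)).map Neg.neg) ∧ KZ.of s - KZ.of s' ∈ KZ.relations := by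
  obtain ⟨s₁, hmem, hbd₁, -, hint₁, hrel₁⟩ := pull (fun _ : Fin (n + 1) => (-1 : ℚ)) (fun _ => 0)
    (fun _ => 0) s M T.L T.e p T.ℓ₁ T.ℓ₂ T.n₁ T.n₂ a (clo A) (chi Bd) h.bdd h.dom h.int
    (fun _ => by norm_num) (hlink_constK (-1) 0 _ _)
  have ha : pullA (fun _ : Fin (n + 1) => (-1 : ℚ)) (fun _ => 0) (fun _ => 0) a =
      fun l => (a l).map Neg.neg := by
    funext l; simp only [pullA, pullC_neg_one]
  set s' := s₁.reindex (revIdx n) with hs'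
  have hrel₂ : KZ.of s₁ - KZ.of s' ∈ KZ.relations :=
    KZ.permRel_subset_relations (KZ.of_sub_of_reindex_mem_permRel s₁ (revIdx n))
  have hdom' : ∀ w, w ∈ s'.domain ↔ (fun i => w (revIdx n i)) ∈ s₁.domain := fun w => by
    rw [hs', KZ.IntegralRep.reindex_domain]; rfl
  -- membership in the reflected chain
  have hmem' : ∀ w, w ∈ s'.domain ↔ yv w ∈ cell M ∧ ev (-Bd) (yv w) < tv w 0 ∧ StrictMono (tv w) ∧
      tv w (Fin.last n) < ev (-A) (yv w) := by
    intro w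
    rw [hdom', hmem, h.mem, yv_pullInv_neg, yv_revIdx, tv_pullInv_neg, tv_revIdx]
    simp only [Fin.rev_zero, Fin.rev_last, ev_neg]
    rw [strictMono_neg_rev]
    constructor
    · rintro ⟨hy, h1, h2, h3⟩; exact ⟨hy, by linarith, h2, by linarith⟩
    · rintro ⟨hy, h1, h2, h3⟩; exact ⟨hy, by linarith, h2, by linarith⟩
  refine ⟨s', ⟨?_, fun w hw => ?_, h.n1, h.n2, fun l c hc => ?_, ?_⟩, ?_⟩
  · ext w; rw [hmem', mem_chain]
  · have hw₁ : (fun i => w (revIdx n i)) ∈ s₁.domain := (hdom' w).1 hw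
    rw [hs', KZ.IntegralRep.reindex_integrand]
    show s₁.integrand (fun i => w (revIdx n i)) = _
    rw [hint₁ hw₁, ha, glit_revIdx]
    rfl
  · rcases h' : a (Fin.rev l) with _ | c₀
    · simp [h'] at hc
    · simp only [h', Option.map_some, Option.some.injEq] at hc
      rw [← hc, neg_fst, h.a0 _ c₀ h', neg_zero]
  · obtain ⟨R, hR⟩ := hbd₁.exists_norm_le
    rw [isBounded_iff_forall_norm_le]
    refine ⟨R, fun w hw => ?_⟩
    have h1 := hR _ ((hdom' w).1 hw)
    refine (pi_norm_le_iff_of_nonneg ((norm_nonneg _).trans h1)).2 fun i => ?_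
    have h2 := norm_le_pi_norm (fun i => w (revIdx n i)) ((revIdx n).symm i)
    simp only [Equiv.apply_symm_apply] at h2
    exact h2.trans h1
  · have := add_mem hrel₁ hrel₂
    rwa [sub_add_sub_cancel] at this

end RebaseChain

/-- Registered support goal of this file (part of `rebaseSimpleZeroMany_common`): the reflection
of a clean chain of `n + 1` fibres is a clean chain (`RebaseChain.IsChain.reflect`). -/
theorem rebaseSimpleZeroMany_chainReflect (n m' : ℕ) (s : KZ.IntegralRep (0 + 1 + (n + 1))) (M : Fin m' → (Fin (0 + 1) → ℚ) × ℚ) (A Bd : (Fin (0 + 1) → ℚ) × ℚ) (T : RebaseZero.BData) (p : MvPolynomial (Fin 0) ℚ) (a : Fin (n + 1) → Option ((Fin (0 + 1) → ℚ) × ℚ)) (h : RebaseChain.IsChain s M A Bd T p a) : ∃ s' : KZ.IntegralRep (0 + 1 + (n + 1)), RebaseChain.IsChain s' M (-Bd) (-A) T (MvPolynomial.C (RebasePos.pullQ (fun _ : Fin (n + 1) => (-1 : ℚ)) a) * p) (fun l => (a (Fin.rev l)).map Neg.neg) ∧ KZ.of s - KZ.of s' ∈ KZ.relations :=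
  h.reflect

end Summit.KontsevichZagierPeriods.ArrangementNormalForm.JanusBands
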